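import Mathlib
import HarnessLib

/-!
# Route `CMKolyvaginAtInertTwo`, crux `CMKolyvaginExactAtInertTwo` (stmt-BirchSwinnertonDyer-24277):
# the INERT-ORDER SPLITTING — an order `ℤ[η]`, `η² + mη = c` with `m, c` odd (i.e. `2` inert in `ℤ[η]`),
# acting on a `2`-group together with an involution `τ` conjugating `η` to `η̄ = −η − m`, makes the
# `τ`-eigen-decomposition EXACT although `2` is not invertible (pure algebra)

Seat `bsd-line-cmk2-p1` g10 (cell `bsd-print-cf2`); helper (`--supports stmt-BirchSwinnertonDyer-24277`).
THEOREMS ONLY (pure algebra in an additive commutative group): no definition, no named fact, no `sorry`;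
no item is closed; BSD is not proved by this.

THE LEVER OF THE ROUTE, ISOLATED. At an odd prime `p` Kolyvagin–McCallum decompose every class into its
`τ`-eigencomponents with `½(1 ± τ)`; at `p = 2` this fails (`V⁺ ∩ V⁻ ⊇` `2`-torsion, `V⁺ + V⁻ ≠ V`), which is
the obstruction met by every `p = 2` descent of this route (KERNEL-STATUS-p2-port.md §§5–7: "one bit
short", "entanglement defect"). On the habitat `H₂` the curve has CM by an order `ℤ[η]` in which `2` is
INERT: `η² + mη = c` with `m` AND `c` odd (`x² + mx − c ≡ x² + x + 1 (mod 2)`; ty2's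
`CartanAtTwo.exists_cmGenerator_of_mem_maximalCMJInvariants`), and every `σ ∉ Γ_F` — in particular complex
conjugation — conjugates `η` to `η̄ = −η − m` (`CartanAtTwo.dichotomy`). For ANY additive group `V` with
commuting data of this shape (`η, τ : V →+ V`, `τ² = 1`, `η τ = τ η̄`) the element
`x₀ = (k+1) + η` (`m = 2k+1`) has TRACE `x₀ + x̄₀ = 1`, and this replaces `½`:

* `eq_add_tau_of_fixed` — `τv = v ⟹ v = x₀v + τ(x₀v)`: **`V^{τ=1} = (1+τ)V`** (`Ĥ⁰(⟨τ⟩, V) = 0`);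
* `eq_sub_tau_of_antifixed` — `τv = −v ⟹ v = x₀v − τ(x₀v)`: **`V^{τ=−1} = (1−τ)V`** (`H¹(⟨τ⟩, V) = 0`);
* `exists_fixed_antifixed_decomp` / `decomp_unique` — **`V = x₀·V⁺ ⊕ V⁻`**, EXACTLY: every `v` is uniquely
  `x₀s + r` with `τs = s`, `τr = −r` (the idempotent `e = x₀(1+τ)`, `e² = e` because `tr x₀ = 1`);
* `norm_zsmul_eq` — `x̄₀(x₀v) = N·v` with `N = −k(k+1) − c` ODD, so on a `2^M`-torsion group `x₀` is
  injective (`x0_injective`) and `x₀V⁺ ≅ V⁺`;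
* `delta_maps_fixed` / `delta_maps_antifixed` / `delta_delta` — `δ = 2η + m` swaps `V⁺` and `V⁻` and
  `δ² = (m² + 4c)·id` with `m² + 4c` odd: on a `2^M`-torsion group **`V⁺ ≃ V⁻`** (`fixedEquivAntifixed`) and
  **`#V = #V⁺ · #V⁻ = (#V⁺)²`** (`natCard_eq_mul`, `natCard_eq_sq`).

Equivalently: `E[2^M] ≅ ℤ/2^M[ω, ω̄]` is the REGULAR representation of `⟨τ⟩` (`τ` permutes the basis
`{ωP, ω̄P}`), and `ℤ/2^M[η]⟨τ⟩ ≅ M₂(ℤ/2^M)` (Morita). Consumers (next seats): `V = E[2^M]` with `τ = c₀`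
(recovers the cyclicity clause of `GenusKolyvaginAtTwo` on `H₂`), and — the point — `V = H¹(KF, E[2^M])`,
`Sel_{2^M}(E/KF)`, `Ш(E/KF)[2^M]`, the local groups at Kolyvagin primes, on which `η_*` and `τ_*` act with
these relations: there the `τ`-parts become honest direct summands and Kolyvagin's descent at `2` can be run
on ONE summand without signs (memo `Cruxes/CMExactDescentAtTwo/MEMO-inert-order-splitting.md`).

References: S. Lang, *Elliptic Functions*, GTM 112, Ch. 10 §4 Remark [Lang1987]; W. McCallum, LMS LN 153
(1991) §5 (the eigen-decomposition at odd `p`) [McCallumLMS1991]; folklore (trace-one elements split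
`C₂`-modules over quadratic orders; `ℤ[ω]` is `ℤ[C₂]`-free on `{ω, ω̄}`).
-/

-- single-conjunct summit: `Summit.BirchSwinnertonDyer.BirchSwinnertonDyer.…` repeats the name by design
set_option linter.dupNamespace false
set_option autoImplicit false

namespace Summit.BirchSwinnertonDyer.BirchSwinnertonDyer.Theorems.InertOrderSplitting

variable {V : Type*} [AddCommGroup V] (η τ : V →+ V) (k c : ℤ)

/-! ## §1 The conjugation relations -/

/-- `τ η τ = η̄ = −η − m`: from `η(τw) = −τ(ηw) − m·τw` and `τ² = 1`, `τ(η(τw)) = −ηw − m·w`. [folklore] -/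
theorem tau_eta_tau (hτ : ∀ v, τ (τ v) = v) (hanti : ∀ v, η (τ v) = -τ (η v) - (2 * k + 1) • τ v)
    (w : V) : τ (η (τ w)) = -η w - (2 * k + 1) • w := by
  have h := hanti (τ w)
  rw [hτ] at h
  -- `h : η w = -τ (η (τ w)) - (2k+1) • w`
  rw [h]; abel

/-- On a `τ`-fixed vector, `τ(ηv) = −ηv − m·v`. [folklore] -/
theorem tau_eta_of_fixed (hτ : ∀ v, τ (τ v) = v)
    (hanti : ∀ v, η (τ v) = -τ (η v) - (2 * k + 1) • τ v) {v : V} (hv : τ v = v) :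
    τ (η v) = -η v - (2 * k + 1) • v := by
  conv_lhs => rw [← hv]
  exact tau_eta_tau η τ k hτ hanti v

/-- On a `τ`-antifixed vector, `τ(ηv) = ηv + m·v`. [folklore] -/
theorem tau_eta_of_antifixed (hτ : ∀ v, τ (τ v) = v)
    (hanti : ∀ v, η (τ v) = -τ (η v) - (2 * k + 1) • τ v) {v : V} (hv : τ v = -v) :
    τ (η v) = η v + (2 * k + 1) • v := by
  have h := tau_eta_tau η τ k hτ hanti (τ v)
  rw [hτ, hv, map_neg, smul_neg] at h
  rw [h]; abel

/-! ## §2 Trace one: `V^{τ=1} = (1+τ)V` and `V^{τ=−1} = (1−τ)V` -/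

/-- **`Ĥ⁰(⟨τ⟩, V) = 0`.** A `τ`-fixed vector is a `(1+τ)`-image: `v = x₀v + τ(x₀v)` with
`x₀v = (k+1)·v + ηv` (`x₀ + x̄₀ = 1`). [folklore] -/
theorem eq_add_tau_of_fixed (hτ : ∀ v, τ (τ v) = v)
    (hanti : ∀ v, η (τ v) = -τ (η v) - (2 * k + 1) • τ v) {v : V} (hv : τ v = v) :
    v = ((k + 1) • v + η v) + τ ((k + 1) • v + η v) := by
  rw [map_add, map_zsmul, hv, tau_eta_of_fixed η τ k hτ hanti hv]
  module

/-- `V^{τ=1} = (1+τ)V`: `τv = v ↔ ∃ w, v = w + τw`. [folklore] -/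
theorem fixed_iff_exists_add_tau (hτ : ∀ v, τ (τ v) = v)
    (hanti : ∀ v, η (τ v) = -τ (η v) - (2 * k + 1) • τ v) (v : V) :
    τ v = v ↔ ∃ w, v = w + τ w := by
  constructor
  · intro hv; exact ⟨_, eq_add_tau_of_fixed η τ k hτ hanti hv⟩
  · rintro ⟨w, rfl⟩; rw [map_add, hτ, add_comm]

/-- **`H¹(⟨τ⟩, V) = 0`.** A `τ`-antifixed vector is a `(1−τ)`-image: `v = x₀v − τ(x₀v)`. [folklore] -/
theorem eq_sub_tau_of_antifixed (hτ : ∀ v, τ (τ v) = v)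
    (hanti : ∀ v, η (τ v) = -τ (η v) - (2 * k + 1) • τ v) {v : V} (hv : τ v = -v) :
    v = ((k + 1) • v + η v) - τ ((k + 1) • v + η v) := by
  rw [map_add, map_zsmul, hv, tau_eta_of_antifixed η τ k hτ hanti hv]
  module

/-- `V^{τ=−1} = (1−τ)V` (`ker(1+τ) = im(1−τ)`): `τv = −v ↔ ∃ w, v = w − τw`. [folklore] -/
theorem antifixed_iff_exists_sub_tau (hτ : ∀ v, τ (τ v) = v)
    (hanti : ∀ v, η (τ v) = -τ (η v) - (2 * k + 1) • τ v) (v : V) :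
    τ v = -v ↔ ∃ w, v = w - τ w := by
  constructor
  · intro hv; exact ⟨_, eq_sub_tau_of_antifixed η τ k hτ hanti hv⟩
  · rintro ⟨w, rfl⟩; rw [map_sub, hτ, neg_sub]

/-! ## §3 The exact splitting `V = x₀V⁺ ⊕ V⁻` -/

/-- **The idempotent `e = x₀(1+τ)`**: with `s = v + τv` and `u = x₀s`, one has `u + τu = s`, i.e.
`e(ev) = ev`. [folklore] -/
theorem add_tau_x0_add_tau (hτ : ∀ v, τ (τ v) = v)
    (hanti : ∀ v, η (τ v) = -τ (η v) - (2 * k + 1) • τ v) (v : V) :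
    ((k + 1) • (v + τ v) + η (v + τ v)) + τ ((k + 1) • (v + τ v) + η (v + τ v)) = v + τ v := by
  have hs : τ (v + τ v) = v + τ v := by rw [map_add, hτ, add_comm]
  exact (eq_add_tau_of_fixed η τ k hτ hanti hs).symm

/-- **Existence of the splitting**: every `v` is `x₀s + r` with `τs = s` and `τr = −r`
(`s = v + τv`, `r = v − x₀s`). [folklore] -/
theorem exists_fixed_antifixed_decomp (hτ : ∀ v, τ (τ v) = v)
    (hanti : ∀ v, η (τ v) = -τ (η v) - (2 * k + 1) • τ v) (v : V) :
    ∃ s r : V, τ s = s ∧ τ r = -r ∧ v = ((k + 1) • s + η s) + r := by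
  refine ⟨v + τ v, v - ((k + 1) • (v + τ v) + η (v + τ v)), by rw [map_add, hτ, add_comm], ?_,
    by abel⟩
  have h := add_tau_x0_add_tau η τ k hτ hanti v
  -- `τ r = τ v - τ u = τ v - (s - u) = u - v = -r`
  rw [map_sub]
  have hu : τ ((k + 1) • (v + τ v) + η (v + τ v)) = v + τ v - ((k + 1) • (v + τ v) + η (v + τ v)) :=
    eq_sub_of_add_eq' h
  rw [hu]; abel

/-- **Uniqueness of the splitting**: `x₀s + r = 0` with `τs = s`, `τr = −r` forces `s = 0` and `r = 0`
(apply `1 + τ`: `s = (x₀s + τx₀s) + (r + τr) = 0`). [folklore] -/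
theorem decomp_unique (hτ : ∀ v, τ (τ v) = v)
    (hanti : ∀ v, η (τ v) = -τ (η v) - (2 * k + 1) • τ v) {s r : V} (hs : τ s = s) (hr : τ r = -r)
    (h0 : ((k + 1) • s + η s) + r = 0) : s = 0 ∧ r = 0 := by
  have hs0 : s = 0 := by
    have h1 := congrArg (fun w ↦ w + τ w) h0
    simp only [map_zero, add_zero, map_add τ ((k + 1) • s + η s) r, hr] at h1
    rw [eq_add_tau_of_fixed η τ k hτ hanti hs]
    rw [← h1]; abel
  refine ⟨hs0, ?_⟩
  rw [hs0, smul_zero, map_zero, add_zero, zero_add] at h0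
  exact h0

/-- Uniqueness, two-sided form: `x₀s + r = x₀s' + r'` with `s, s'` fixed and `r, r'` antifixed forces
`s = s'` and `r = r'`. [folklore] -/
theorem decomp_unique' (hτ : ∀ v, τ (τ v) = v)
    (hanti : ∀ v, η (τ v) = -τ (η v) - (2 * k + 1) • τ v) {s r s' r' : V} (hs : τ s = s)
    (hr : τ r = -r) (hs' : τ s' = s') (hr' : τ r' = -r')
    (h : ((k + 1) • s + η s) + r = ((k + 1) • s' + η s') + r') : s = s' ∧ r = r' := by
  have h0 : ((k + 1) • (s - s') + η (s - s')) + (r - r') = 0 := by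
    rw [smul_sub, map_sub, ← sub_eq_zero.mpr h]; abel
  have hss : τ (s - s') = s - s' := by rw [map_sub, hs, hs']
  have hrr : τ (r - r') = -(r - r') := by rw [map_sub, hr, hr']; abel
  obtain ⟨h1, h2⟩ := decomp_unique η τ k hτ hanti hss hrr h0
  exact ⟨sub_eq_zero.mp h1, sub_eq_zero.mp h2⟩

/-! ## §4 `x₀` and `δ = 2η + m` are units on a `2`-group: `x₀V⁺ ≅ V⁺ ≅ V⁻`, `#V = (#V⁺)²` -/

/-- **The norm of `x₀`**: `x̄₀(x₀v) = N·v` with `x̄₀ = −k − η`, `N = −k(k+1) − c`. [folklore] -/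
theorem norm_zsmul_eq (hrel : ∀ v, η (η v) + (2 * k + 1) • η v = c • v) (v : V) :
    (-k) • ((k + 1) • v + η v) - η ((k + 1) • v + η v) = (-(k * (k + 1)) - c) • v := by
  rw [map_add, map_zsmul, show η (η v) = c • v - (2 * k + 1) • η v from eq_sub_of_add_eq (hrel v)]
  module

/-- `N = −k(k+1) − c` is odd when `c` is. [folklore] -/
theorem odd_norm (hc : Odd c) : Odd (-(k * (k + 1)) - c) := by
  have h : -(k * (k + 1)) - c = -(k * (k + 1) + c) := by ring
  rw [h]
  exact ((Int.even_mul_succ_self k).add_odd hc).neg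

/-- An odd integer acts injectively on an additive group killed by `2^M`. [folklore] -/
theorem eq_of_odd_zsmul_eq {N : ℤ} (hN : Odd N) {M : ℕ} (htor : ∀ v : V, ((2 : ℤ) ^ M) • v = 0)
    {a b : V} (h : N • a = N • b) : a = b := by
  have hcop : IsCoprime N ((2 : ℤ) ^ M) := by
    obtain ⟨j, rfl⟩ := hN
    exact (show IsCoprime (2 * j + 1) (2 : ℤ) from ⟨1, -j, by ring⟩).pow_right
  obtain ⟨u, w, huw⟩ := hcop
  calc a = (u * N + w * 2 ^ M) • a := by rw [huw, one_zsmul]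
    _ = u • (N • b) := by rw [add_zsmul, mul_zsmul, mul_zsmul, htor, zsmul_zero, add_zero, h]
    _ = (u * N + w * 2 ^ M) • b := by rw [add_zsmul, mul_zsmul, mul_zsmul, htor, zsmul_zero, add_zero]
    _ = b := by rw [huw, one_zsmul]

/-- **`x₀` is injective on a `2`-group** (`c` odd): `x₀V⁺ ≅ V⁺`, and `ker e = V⁻` exactly. [folklore] -/
theorem x0_injective (hrel : ∀ v, η (η v) + (2 * k + 1) • η v = c • v) (hc : Odd c) {M : ℕ}
    (htor : ∀ v : V, ((2 : ℤ) ^ M) • v = 0) :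
    Function.Injective (fun v : V ↦ (k + 1) • v + η v) := by
  intro a b h
  have h' := congrArg (fun w : V ↦ (-k) • w - η w) h
  simp only [norm_zsmul_eq η k c hrel] at h'
  exact eq_of_odd_zsmul_eq (odd_norm k c hc) htor h'

/-- `ev = 0 ↔ τv = −v` on a `2`-group: the kernel of the idempotent `e = x₀(1+τ)` is exactly `V⁻`.
[folklore] -/
theorem x0_add_tau_eq_zero_iff (hrel : ∀ v, η (η v) + (2 * k + 1) • η v = c • v) (hc : Odd c) {M : ℕ}
    (htor : ∀ v : V, ((2 : ℤ) ^ M) • v = 0) (v : V) :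
    (k + 1) • (v + τ v) + η (v + τ v) = 0 ↔ τ v = -v := by
  constructor
  · intro h
    have h0 : v + τ v = 0 := by
      apply x0_injective η k c hrel hc htor
      simp only [smul_zero, map_zero, add_zero]
      exact h
    exact (neg_eq_of_add_eq_zero_right h0).symm
  · intro hv
    rw [hv, add_neg_cancel, smul_zero, map_zero, add_zero]

/-- `δ = 2η + m` maps `V⁺` into `V⁻`. [folklore] -/
theorem tau_delta_of_fixed (hτ : ∀ v, τ (τ v) = v)
    (hanti : ∀ v, η (τ v) = -τ (η v) - (2 * k + 1) • τ v) {v : V} (hv : τ v = v) :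
    τ ((2 : ℤ) • η v + (2 * k + 1) • v) = -((2 : ℤ) • η v + (2 * k + 1) • v) := by
  rw [map_add, map_zsmul, map_zsmul, hv, tau_eta_of_fixed η τ k hτ hanti hv]
  module

/-- `δ = 2η + m` maps `V⁻` into `V⁺`. [folklore] -/
theorem tau_delta_of_antifixed (hτ : ∀ v, τ (τ v) = v)
    (hanti : ∀ v, η (τ v) = -τ (η v) - (2 * k + 1) • τ v) {v : V} (hv : τ v = -v) :
    τ ((2 : ℤ) • η v + (2 * k + 1) • v) = (2 : ℤ) • η v + (2 * k + 1) • v := by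
  rw [map_add, map_zsmul, map_zsmul, hv, tau_eta_of_antifixed η τ k hτ hanti hv]
  module

/-- **`δ² = (m² + 4c)·id`** (`δ = 2η + m = η − η̄ = "√disc"`). [folklore] -/
theorem delta_delta (hrel : ∀ v, η (η v) + (2 * k + 1) • η v = c • v) (v : V) :
    (2 : ℤ) • η ((2 : ℤ) • η v + (2 * k + 1) • v) + (2 * k + 1) • ((2 : ℤ) • η v + (2 * k + 1) • v) =
      ((2 * k + 1) ^ 2 + 4 * c) • v := by
  rw [map_add, map_zsmul, map_zsmul,
    show η (η v) = c • v - (2 * k + 1) • η v from eq_sub_of_add_eq (hrel v)]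
  module

/-- `m² + 4c` is odd. [folklore] -/
theorem odd_disc : Odd ((2 * k + 1) ^ 2 + 4 * c) :=
  ⟨2 * k ^ 2 + 2 * k + 2 * c, by ring⟩

/-- **`V⁺ ≅ V⁻` on a `2`-group** (via `δ`, inverted by the odd integer `m² + 4c`): equal cardinalities.
[folklore] -/
theorem natCard_fixed_eq_natCard_antifixed (hrel : ∀ v, η (η v) + (2 * k + 1) • η v = c • v)
    (hτ : ∀ v, τ (τ v) = v) (hanti : ∀ v, η (τ v) = -τ (η v) - (2 * k + 1) • τ v) {M : ℕ}
    (htor : ∀ v : V, ((2 : ℤ) ^ M) • v = 0) :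
    Nat.card {v : V // τ v = v} = Nat.card {v : V // τ v = -v} := by
  have hcop : IsCoprime ((2 * k + 1) ^ 2 + 4 * c) ((2 : ℤ) ^ M) := by
    obtain ⟨j, hj⟩ := odd_disc k c
    rw [hj]
    exact (show IsCoprime (2 * j + 1) (2 : ℤ) from ⟨1, -j, by ring⟩).pow_right
  obtain ⟨u, w, huw⟩ := hcop
  -- `δ` and `u·δ` are mutually inverse bijections `V⁺ ⇄ V⁻`
  have hinv : ∀ v : V, u • ((2 : ℤ) • η ((2 : ℤ) • η v + (2 * k + 1) • v) +
      (2 * k + 1) • ((2 : ℤ) • η v + (2 * k + 1) • v)) = v := by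
    intro v
    have h2 : (w * 2 ^ M) • v = 0 := by rw [mul_smul, htor, smul_zero]
    rw [delta_delta η k c hrel, smul_smul]
    calc (u * ((2 * k + 1) ^ 2 + 4 * c)) • v
        = (u * ((2 * k + 1) ^ 2 + 4 * c)) • v + (w * 2 ^ M) • v := by rw [h2, add_zero]
      _ = v := by rw [← add_smul, huw, one_smul]
  refine Nat.card_congr
    { toFun := fun v ↦ ⟨(2 : ℤ) • η v.1 + (2 * k + 1) • v.1, tau_delta_of_fixed η τ k hτ hanti v.2⟩
      invFun := fun v ↦ ⟨u • ((2 : ℤ) • η v.1 + (2 * k + 1) • v.1), by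
        rw [map_zsmul, tau_delta_of_antifixed η τ k hτ hanti v.2]⟩
      left_inv := fun v ↦ Subtype.ext (hinv v.1)
      right_inv := fun v ↦ Subtype.ext (by
        change (2 : ℤ) • η (u • ((2 : ℤ) • η v.1 + (2 * k + 1) • v.1)) +
            (2 * k + 1) • (u • ((2 : ℤ) • η v.1 + (2 * k + 1) • v.1)) = v.1
        rw [map_zsmul, smul_comm (2 : ℤ) u, smul_comm (2 * k + 1) u, ← smul_add]
        exact hinv v.1) }

/-- **`#V = #V⁺ · #V⁻`**: `1 − τ : V → V⁻` is onto (`V⁻ = (1−τ)V`) with kernel `V⁺`. [folklore] -/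
theorem natCard_eq_mul (hτ : ∀ v, τ (τ v) = v)
    (hanti : ∀ v, η (τ v) = -τ (η v) - (2 * k + 1) • τ v) :
    Nat.card V = Nat.card {v : V // τ v = v} * Nat.card {v : V // τ v = -v} := by
  set f : V →+ V := AddMonoidHom.id V - τ with hf
  have hfapp : ∀ v, f v = v - τ v := fun v ↦ rfl
  have hker : Nat.card f.ker = Nat.card {v : V // τ v = v} := by
    refine Nat.card_congr (Equiv.subtypeEquivRight fun v ↦ ?_)
    rw [AddMonoidHom.mem_ker, hfapp, sub_eq_zero, eq_comm]
  have hrange : Nat.card f.range = Nat.card {v : V // τ v = -v} := by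
    refine Nat.card_congr (Equiv.subtypeEquivRight fun v ↦ ?_)
    rw [AddMonoidHom.mem_range, antifixed_iff_exists_sub_tau η τ k hτ hanti]
    simp only [hfapp, eq_comm]
  rw [← hker, ← hrange, ← Nat.card_congr (QuotientAddGroup.quotientKerEquivRange f).toEquiv, mul_comm]
  exact AddSubgroup.card_eq_card_quotient_mul_card_addSubgroup f.ker

/-- **`#V = (#V⁺)²` on a `2`-group.** With `V = H¹`, `Sel` or `Ш` over `KF` this is the exact form of
"`Ш ≅ Ш⁺ ⊕ Ш⁻`" that fails for the naive eigenspaces at `2`. [folklore] -/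
theorem natCard_eq_sq (hrel : ∀ v, η (η v) + (2 * k + 1) • η v = c • v) (hτ : ∀ v, τ (τ v) = v)
    (hanti : ∀ v, η (τ v) = -τ (η v) - (2 * k + 1) • τ v) {M : ℕ}
    (htor : ∀ v : V, ((2 : ℤ) ^ M) • v = 0) :
    Nat.card V = Nat.card {v : V // τ v = v} ^ 2 := by
  rw [natCard_eq_mul η τ k hτ hanti, ← natCard_fixed_eq_natCard_antifixed η τ k c hrel hτ hanti htor, sq]

end Summit.BirchSwinnertonDyer.BirchSwinnertonDyer.Theorems.InertOrderSplitting
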